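import Literature.Probability.Percolation.TwoClusterGibbsCovariance
import Literature.Probability.Percolation.KozmaNitzanSeparatingTriple
import HarnessLib

/-!
# The observer-union margin H-ν(F) is bounded below by its value at the conditional expectation `E[F | C_X]`
# (world decomposition along the avoided cluster + Harris inside each world)   (PAPER-2 track (ii); seat `prim-consts-2`, gen 14)

builds on p205010 (kernel theorem, internal audit signed; external expert review pending).  Support file (`--supports
stmt-CriticalPhenomena-4575`); memo `run/shared/lean/prim/consts/FROM-prim-consts-2-g14-DUAL-HNU.md` §2.  No definitions, no named facts,
no sorries; standard axioms.

Notation: owner `s`, avoided set `X`, markers `y, z`; `D = {s ↮ X}`, `T = {y ↮ {s}∪X} ∩ D`, `W = {y ↔ z}`, `G_y = {y ↔ X}`,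
`B' = {s ↔ z} ∪ (W ∩ {y ↮ X})` (the observer union), `C_s` / `C_X` the open edge clusters, and for a functional `F` of `C_s` the
conditional expectation given the avoided cluster, `F̂(B) = E[F(C_s) | C_X = B]` — van den Berg–Häggström–Kahn's half-step
(`BHK2006.condS w {s} X F B`: the cluster of `s` in a fresh configuration with the pairs meeting `X ∪ V(B)` deleted, Lemma 2.4), an
ANTITONE functional of `C_X` when `F` is monotone (`BHK2006.condS_antitone`, Remark 2.8).  The H-ν margin of a test `Φ : BondConfig → ℝ` is
  `Hν(Φ) = μ(T)·[μ(D)∫_{D∩B'} Φ − (∫_D Φ) μ(D∩B')] + μ(T∩W)·[μ(D)∫_{D∩G_y} Φ − (∫_D Φ) μ(D∩G_y)]`.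

* `Consts.openEdgeCluster_setCl` — reading `C_s` off the set cluster `C_S`, `s ∈ S`.
* `Consts.setIntegral_avoid_eq_condS`, `Consts.setIntegral_avoid_swallow_eq_condS` — the tower identities
  `∫_D F(C_s) = ∫_D F̂(C_X)` and `∫_{D∩G_y} F(C_s) = ∫_{D∩G_y} F̂(C_X)` (Lemma 2.4 summed, `BHK2006.set_sum_cond_cluster'`).
* `Consts.setIntegral_avoid_observer_ge_condS` — **the only inequality**: `∫_{D∩B'} F(C_s) ≥ ∫_{D∩B'} F̂(C_X)` for monotone `F`.  On
  `D ∩ G_y` the observer union is `{s ↔ z}`, read off the fresh cluster of `s`; on `D ∩ {y ↮ X}` it is `{z ↔ {s,y}}`, read off the fresh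
  cluster of the SET `{s,y}` (conditioning on `C_X` with `{s,y} ↮ X`, `BHK2006.set_sum_cond_cluster` for the pair `(X, {s,y})`); in both
  cases Harris' inequality in the fresh configuration (`BHK2006.harris`) bounds `E[F·1_{B'} | C_X]` below by `F̂·P(B' | C_X)`.
Consequence (companion file `…ConstsHnuMDLXIdentity.lean`, `Consts.hnu_ge_hnu_condS`): `Hν(F ∘ C_s) ≥ Hν(F̂ ∘ C_X)` for every monotone `F`
(law of total covariance along `σ(C_X)`, within-world part `≥ 0`); with the conjecture `Consts.AvoidedClusterRepulsion` (gen 14) this gives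
H-ν for every monotone functional of `C_s`.
[cite: VandenbergHaggstromKahn2005, §2.1 Lemmas 2.3–2.4 (p. 10), Remark 2.8 (p. 12); §1 p. 4 display (4) (Harris)]
-/

noncomputable section

namespace Summit.CriticalPhenomena.PercolationContinuityZ3.Theorems

open MeasureTheory Set Literature.Probability.LatticeModels Literature.Probability.Percolation
open Literature.Probability.Percolation.BHK2006
open Literature.Probability.Percolation.DecisionTree (ind ind_of_mem ind_of_not_mem ind_nonneg)
open scoped Classical

namespace Consts

variable {V : Type*} [Fintype V]

omit [Fintype V] in
/-- **`C_s` read off `C_S`** (`s ∈ S`): the open edge cluster of `s` in the sub-configuration `C_S = ⋃_{t∈S} C_t` is `C_s` itself.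
[cite: VandenbergHaggstromKahn2005, §2.1 p. 9 (definition of `C_S`)] -/
theorem openEdgeCluster_setCl (η : BondConfig V) (S : Set V) {s : V} (hs : s ∈ S) :
    openEdgeCluster (setCl η S) s = openEdgeCluster η s := by
  ext e
  rw [mem_openEdgeCluster_iff, mem_openEdgeCluster_iff]
  constructor
  · rintro ⟨he, hd, hr⟩
    exact ⟨setCl_subset η S he, hd, fun v hv => (KNSep.reachable_iff_cluster η S hs v).2 (hr v hv)⟩
  · rintro ⟨he, hd, hr⟩
    refine ⟨(mem_setCl_iff η S e).2 ⟨s, hs, (mem_openEdgeCluster_iff η s e).2 ⟨he, hd, hr⟩⟩, hd,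
      fun v hv => (KNSep.reachable_iff_cluster η S hs v).1 (hr v hv)⟩

/-! ### Integrals as weighted sums -/

/-- Total mass of the product weights is `1`. [folklore] -/
private theorem sum_weight_eq_one (w : Sym2 V → unitInterval) :
    ∑ ω : Set (Sym2 V), weight (fun e => (w e : ℝ)) ω = 1 := by
  have h1 := integral_prodBernoulli_eq_sum w fun _ => (1 : ℝ)
  simp only [integral_const, probReal_univ, smul_eq_mul, mul_one] at h1
  exact h1.symm

/-- A set integral as a weighted sum with the indicator `ind`. [folklore] -/
private theorem setIntegral_eq_sum_ind (w : Sym2 V → unitInterval) (S : Set (BondConfig V)) (ψ : BondConfig V → ℝ) :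
    ∫ ω in S, ψ ω ∂(prodBernoulli w) = ∑ ω, weight (fun e => (w e : ℝ)) ω * (ψ ω * ind S ω) := by
  rw [← integral_indicator (MeasurableSet.of_discrete), integral_prodBernoulli_eq_sum]
  refine Finset.sum_congr rfl fun ω _ => ?_
  by_cases hω : ω ∈ S
  · rw [Set.indicator_of_mem hω, ind_of_mem hω, mul_one]
  · simp [Set.indicator_of_notMem hω, ind_of_not_mem hω]

omit [Fintype V] in
/-- `ind (A ∩ B) = ind A * ind B`. [folklore] -/
private theorem ind_inter (A B : Set (BondConfig V)) (ω : BondConfig V) : ind (A ∩ B) ω = ind A ω * ind B ω := by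
  by_cases hA : ω ∈ A <;> by_cases hB : ω ∈ B
  · rw [ind_of_mem (show ω ∈ A ∩ B from ⟨hA, hB⟩), ind_of_mem hA, ind_of_mem hB, mul_one]
  · rw [ind_of_not_mem (fun h => hB h.2), ind_of_mem hA, ind_of_not_mem hB, mul_zero]
  · rw [ind_of_not_mem (fun h => hA h.1), ind_of_not_mem hA, zero_mul]
  · rw [ind_of_not_mem (fun h => hA h.1), ind_of_not_mem hA, zero_mul]

/-! ### The tower identities along `σ(C_X)` -/

omit [Fintype V] in
/-- `D = {s ↮ X}` in the two-set form used by `BHK2006.set_sum_cond_cluster`. [folklore] -/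
private theorem mem_D_iff' (s : V) (X : Set V) (ω : BondConfig V) :
    ω ∈ {ω : BondConfig V | ∀ x ∈ X, ¬ (openGraph ω).Reachable s x} ↔
      ∀ s' ∈ ({s} : Set V), ∀ t ∈ X, ¬ (openGraph ω).Reachable s' t := by
  simp only [Set.mem_setOf_eq, Set.mem_singleton_iff, forall_eq]

/-- **Tower identity `∫_D F(C_s) = ∫_D F̂(C_X)`** (Lemma 2.4 summed). [cite: VandenbergHaggstromKahn2005, §2.1 Lemma 2.4 (p. 10)] -/
theorem setIntegral_avoid_eq_condS (w : Sym2 V → unitInterval) (s : V) (X : Set V) (F : Set (Sym2 V) → ℝ) :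
    ∫ ω in {ω : BondConfig V | ∀ x ∈ X, ¬ (openGraph ω).Reachable s x}, F (openEdgeCluster ω s) ∂(prodBernoulli w) =
      ∫ ω in {ω : BondConfig V | ∀ x ∈ X, ¬ (openGraph ω).Reachable s x},
        condS (fun e => (w e : ℝ)) {s} X F (⋃ x ∈ X, openEdgeCluster ω x) ∂(prodBernoulli w) := by
  set D : Set (BondConfig V) := {ω | ∀ x ∈ X, ¬ (openGraph ω).Reachable s x} with hDdef
  set wr : Sym2 V → ℝ := fun e => (w e : ℝ) with hwr
  rw [setIntegral_eq_sum_ind, setIntegral_eq_sum_ind]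
  have e1 : ∀ ω, weight wr ω * (F (openEdgeCluster ω s) * ind D ω) =
      weight wr ω * ((fun A (_ : Set (Sym2 V)) => F A) (setCl ω {s}) (setCl ω X) * ind D ω) := by
    intro ω; rw [setCl_singleton]
  have e2 : ∀ ω, weight wr ω * (condS wr {s} X F (⋃ x ∈ X, openEdgeCluster ω x) * ind D ω) =
      weight wr ω * ((∑ η, weight wr η * (fun A (_ : Set (Sym2 V)) => F A) (setCl (η \ barOf X (setCl ω X)) {s}) (setCl ω X)) *
        ind D ω) := fun ω => rfl
  rw [Finset.sum_congr rfl fun ω _ => e1 ω, Finset.sum_congr rfl fun ω _ => e2 ω]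
  exact set_sum_cond_cluster' wr (sum_weight_eq_one w) {s} X (fun A _ => F A) (mem_D_iff' s X)

omit [Fintype V] in
/-- `G_y = {y ↔ X}` read off `C_X`. [cite: VandenbergHaggstromKahn2005, §1 p. 3] -/
private theorem mem_Gy_iff_setCl (X : Set V) (y : V) (ω : BondConfig V) :
    (∃ x ∈ X, (openGraph ω).Reachable y x) ↔ (y ∈ X ∨ ∃ e ∈ setCl ω X, y ∈ e) := by
  rw [← setReach_iff ω X y]
  exact ⟨fun ⟨x, hx, h⟩ => ⟨x, hx, h.symm⟩, fun ⟨x, hx, h⟩ => ⟨x, hx, h.symm⟩⟩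

/-- **Tower identity on the swallowing event: `∫_{D∩G_y} F(C_s) = ∫_{D∩G_y} F̂(C_X)`** (`G_y` is determined by `C_X`).
[cite: VandenbergHaggstromKahn2005, §2.1 Lemma 2.4 (p. 10)] -/
theorem setIntegral_avoid_swallow_eq_condS (w : Sym2 V → unitInterval) (s y : V) (X : Set V) (F : Set (Sym2 V) → ℝ) :
    ∫ ω in {ω : BondConfig V | ∀ x ∈ X, ¬ (openGraph ω).Reachable s x} ∩ {ω | ∃ x ∈ X, (openGraph ω).Reachable y x},
        F (openEdgeCluster ω s) ∂(prodBernoulli w) =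
      ∫ ω in {ω : BondConfig V | ∀ x ∈ X, ¬ (openGraph ω).Reachable s x} ∩ {ω | ∃ x ∈ X, (openGraph ω).Reachable y x},
        condS (fun e => (w e : ℝ)) {s} X F (⋃ x ∈ X, openEdgeCluster ω x) ∂(prodBernoulli w) := by
  set D : Set (BondConfig V) := {ω | ∀ x ∈ X, ¬ (openGraph ω).Reachable s x} with hDdef
  set Gy : Set (BondConfig V) := {ω | ∃ x ∈ X, (openGraph ω).Reachable y x} with hGy
  set wr : Sym2 V → ℝ := fun e => (w e : ℝ) with hwr
  -- the swallowing indicator as a function of `C_X`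
  set gB : Set (Sym2 V) → ℝ := fun B => if (y ∈ X ∨ ∃ e ∈ B, y ∈ e) then 1 else 0 with hgB
  have hGyind : ∀ ω, ind Gy ω = gB (setCl ω X) := by
    intro ω
    by_cases h : ω ∈ Gy
    · rw [ind_of_mem h, hgB]; simp only
      rw [if_pos ((mem_Gy_iff_setCl X y ω).1 h)]
    · rw [ind_of_not_mem h, hgB]; simp only
      rw [if_neg (fun h' => h ((mem_Gy_iff_setCl X y ω).2 h'))]
  rw [setIntegral_eq_sum_ind, setIntegral_eq_sum_ind]
  have e1 : ∀ ω, weight wr ω * (F (openEdgeCluster ω s) * ind (D ∩ Gy) ω) =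
      weight wr ω * ((fun A B => F A * gB B) (setCl ω {s}) (setCl ω X) * ind D ω) := by
    intro ω; rw [ind_inter, setCl_singleton, hGyind ω]; ring
  have e2 : ∀ ω, weight wr ω * (condS wr {s} X F (⋃ x ∈ X, openEdgeCluster ω x) * ind (D ∩ Gy) ω) =
      weight wr ω * ((∑ η, weight wr η * (fun A B => F A * gB B) (setCl (η \ barOf X (setCl ω X)) {s}) (setCl ω X)) *
        ind D ω) := by
    intro ω
    rw [ind_inter, hGyind ω]
    have hc : condS wr {s} X F (⋃ x ∈ X, openEdgeCluster ω x) =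
        ∑ η, weight wr η * F (setCl (η \ barOf X (setCl ω X)) {s}) := rfl
    rw [hc]
    have hs : ∑ η, weight wr η * (fun A B => F A * gB B) (setCl (η \ barOf X (setCl ω X)) {s}) (setCl ω X) =
        (∑ η, weight wr η * F (setCl (η \ barOf X (setCl ω X)) {s})) * gB (setCl ω X) := by
      rw [Finset.sum_mul]
      exact Finset.sum_congr rfl fun η _ => by ring
    rw [hs]; ring
  rw [Finset.sum_congr rfl fun ω _ => e1 ω, Finset.sum_congr rfl fun ω _ => e2 ω]
  exact set_sum_cond_cluster' wr (sum_weight_eq_one w) {s} X (fun A B => F A * gB B) (mem_D_iff' s X)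

/-! ### The within-world Harris step -/

/-- Harris in the fresh configuration, shifted: for monotone `f` (any sign) and monotone `g` with values in `[0,1]`,
`(Σ w f)(Σ w g) ≤ Σ w (f g)`. [cite: VandenbergHaggstromKahn2005, §1 p. 4 display (4) (Harris)] -/
private theorem harris_shift (w : Sym2 V → unitInterval) {f g : Set (Sym2 V) → ℝ} (hf : Monotone f) (hg : Monotone g)
    (hg0 : ∀ a, 0 ≤ g a) :
    (∑ η, weight (fun e => (w e : ℝ)) η * f η) * (∑ η, weight (fun e => (w e : ℝ)) η * g η) ≤
      ∑ η, weight (fun e => (w e : ℝ)) η * (f η * g η) := by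
  set wr : Sym2 V → ℝ := fun e => (w e : ℝ) with hwr
  have hw0 : ∀ e, 0 ≤ wr e := fun e => (w e).2.1
  have hw1 : ∀ e, wr e ≤ 1 := fun e => (w e).2.2
  have hm := sum_weight_eq_one w
  have h := harris hw0 hw1 (f := fun a => f a - f ∅) (g := g) (fun a => sub_nonneg.2 (hf (empty_subset a))) hg0
    (fun a b hab => sub_le_sub_right (hf hab) _) hg
  have hm' : ∑ η, weight wr η = 1 := hm
  rw [hm', one_mul] at h
  have e1 : ∑ η, weight wr η * (f η - f ∅) = (∑ η, weight wr η * f η) - f ∅ := by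
    have : ∀ η, weight wr η * (f η - f ∅) = weight wr η * f η - weight wr η * f ∅ := fun η => mul_sub _ _ _
    rw [Finset.sum_congr rfl fun η _ => this η, Finset.sum_sub_distrib, ← Finset.sum_mul, hm', one_mul]
  have e2 : ∑ η, weight wr η * ((f η - f ∅) * g η) = (∑ η, weight wr η * (f η * g η)) - f ∅ * ∑ η, weight wr η * g η := by
    have : ∀ η, weight wr η * ((f η - f ∅) * g η) = weight wr η * (f η * g η) - f ∅ * (weight wr η * g η) := fun η => by ring
    rw [Finset.sum_congr rfl fun η _ => this η, Finset.sum_sub_distrib, ← Finset.mul_sum]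
  rw [e1, e2] at h
  nlinarith [h]

/-- **The within-world inequality `∫_{D∩B'} F(C_s) ≥ ∫_{D∩B'} F̂(C_X)`** for monotone `F`, `B' = {s↔z} ∪ ({y↔z} ∩ {y ↮ X})`:
conditionally on the avoided cluster `C_X` (Lemma 2.4), `F(C_s)` and `1_{B'}` are increasing functions of the fresh configuration, so
`E[F·1_{B'} | C_X] ≥ E[F | C_X]·P(B' | C_X)` (Harris), and summing over the worlds gives the claim.  The observer union is read off the
fresh cluster of `s` on `{y ↔ X}` and off the fresh cluster of the set `{s,y}` on `{y ↮ X}`.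
[cite: VandenbergHaggstromKahn2005, §2.1 Lemmas 2.3–2.4 (p. 10); §1 p. 4 display (4)] -/
theorem setIntegral_avoid_observer_ge_condS (w : Sym2 V → unitInterval) (s y z : V) (X : Set V)
    {F : Set (Sym2 V) → ℝ} (hF : Monotone F) :
    ∫ ω in {ω : BondConfig V | ∀ x ∈ X, ¬ (openGraph ω).Reachable s x} ∩
        (openConn s z ∪ (openConn y z ∩ {ω | ∀ x ∈ X, ¬ (openGraph ω).Reachable y x})),
        condS (fun e => (w e : ℝ)) {s} X F (⋃ x ∈ X, openEdgeCluster ω x) ∂(prodBernoulli w) ≤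
      ∫ ω in {ω : BondConfig V | ∀ x ∈ X, ¬ (openGraph ω).Reachable s x} ∩
        (openConn s z ∪ (openConn y z ∩ {ω | ∀ x ∈ X, ¬ (openGraph ω).Reachable y x})),
        F (openEdgeCluster ω s) ∂(prodBernoulli w) := by
  set μ := prodBernoulli w with hμ
  set wr : Sym2 V → ℝ := fun e => (w e : ℝ) with hwr
  have hw0 : ∀ e, 0 ≤ wr e := fun e => (w e).2.1
  have hw1 : ∀ e, wr e ≤ 1 := fun e => (w e).2.2
  have hm : ∑ ω, weight wr ω = 1 := sum_weight_eq_one w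
  set D : Set (BondConfig V) := {ω | ∀ x ∈ X, ¬ (openGraph ω).Reachable s x} with hDdef
  set Ay : Set (BondConfig V) := {ω | ∀ x ∈ X, ¬ (openGraph ω).Reachable y x} with hAy
  set Gy : Set (BondConfig V) := {ω | ∃ x ∈ X, (openGraph ω).Reachable y x} with hGy
  set Zv : Set (BondConfig V) := openConn s z with hZv
  set Wv : Set (BondConfig V) := openConn y z with hWv
  set Bp : Set (BondConfig V) := Zv ∪ (Wv ∩ Ay) with hBp
  -- `D' = {X ↮ {s,y}} = D ∩ Ay` and `ZW = {z ↔ {s,y}}`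
  set D' : Set (BondConfig V) := {ω | ∀ a ∈ X, ∀ t ∈ ({s, y} : Set V), ¬ (openGraph ω).Reachable a t} with hD'
  set ZW : Set (BondConfig V) := {ω | ∃ a ∈ ({s, y} : Set V), (openGraph ω).Reachable a z} with hZW
  have mD : ∀ ω, ω ∈ D ↔ ∀ x ∈ X, ¬ (openGraph ω).Reachable s x := fun ω => Iff.rfl
  have mAy : ∀ ω, ω ∈ Ay ↔ ∀ x ∈ X, ¬ (openGraph ω).Reachable y x := fun ω => Iff.rfl
  have mGy : ∀ ω, ω ∈ Gy ↔ ∃ x ∈ X, (openGraph ω).Reachable y x := fun ω => Iff.rfl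
  have mZ : ∀ ω, ω ∈ Zv ↔ (openGraph ω).Reachable s z := fun ω => Iff.rfl
  have mW : ∀ ω, ω ∈ Wv ↔ (openGraph ω).Reachable y z := fun ω => Iff.rfl
  have mBp : ∀ ω, ω ∈ Bp ↔ ω ∈ Zv ∨ (ω ∈ Wv ∧ ω ∈ Ay) := fun ω => by simp only [hBp, mem_union, mem_inter_iff]
  have mD' : ∀ ω, ω ∈ D' ↔ ω ∈ D ∧ ω ∈ Ay := by
    intro ω
    simp only [hD', mem_setOf_eq, mem_insert_iff, mem_singleton_iff, forall_eq_or_imp, forall_eq, mD, mAy]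
    constructor
    · intro h
      exact ⟨fun x hx hsx => (h x hx).1 hsx.symm, fun x hx hyx => (h x hx).2 hyx.symm⟩
    · rintro ⟨h1, h2⟩ x hx
      exact ⟨fun hxs => h1 x hx hxs.symm, fun hxy => h2 x hx hxy.symm⟩
  have mZW : ∀ ω, ω ∈ ZW ↔ (openGraph ω).Reachable s z ∨ (openGraph ω).Reachable y z := by
    intro ω; simp only [hZW, mem_setOf_eq, mem_insert_iff, mem_singleton_iff, exists_eq_or_imp, exists_eq_left]
  -- the partition `D ∩ B' = (D ∩ G_y ∩ Z) ⊔ (D' ∩ ZW)` at the level of indicators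
  have hsplit : ∀ ω, ind (D ∩ Bp) ω = ind (D ∩ Gy ∩ Zv) ω + ind (D' ∩ ZW) ω := by
    intro ω
    by_cases hd : ω ∈ D
    · by_cases hg : ω ∈ Gy
      · -- swallowed: `B' = Z`, `ω ∉ D'`
        have hnD' : ω ∉ D' ∩ ZW := by
          rintro ⟨h1, -⟩
          rw [mD'] at h1
          obtain ⟨x, hx, hyx⟩ := hg
          exact h1.2 x hx hyx
        rw [ind_of_not_mem hnD', add_zero]
        by_cases hz : ω ∈ Zv
        · rw [ind_of_mem (show ω ∈ D ∩ Bp from ⟨hd, (mBp ω).2 (Or.inl hz)⟩),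
            ind_of_mem (show ω ∈ D ∩ Gy ∩ Zv from ⟨⟨hd, hg⟩, hz⟩)]
        · have hnb : ω ∉ D ∩ Bp := by
            rintro ⟨-, hb⟩
            rcases (mBp ω).1 hb with hz' | ⟨-, hay⟩
            · exact hz hz'
            · obtain ⟨x, hx, hyx⟩ := hg
              exact hay x hx hyx
          rw [ind_of_not_mem hnb, ind_of_not_mem (fun h => hz h.2)]
      · -- not swallowed: `B' = Z ∪ W = ZW`, `ω ∈ D'`
        have hay : ω ∈ Ay := by
          rw [mAy]; intro x hx hyx; exact hg ⟨x, hx, hyx⟩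
        have hD'ω : ω ∈ D' := (mD' ω).2 ⟨hd, hay⟩
        rw [ind_of_not_mem (fun h : ω ∈ D ∩ Gy ∩ Zv => hg h.1.2), zero_add]
        by_cases hzw : ω ∈ ZW
        · have hb : ω ∈ D ∩ Bp := by
            refine ⟨hd, (mBp ω).2 ?_⟩
            rcases (mZW ω).1 hzw with hsz | hyz
            · exact Or.inl hsz
            · exact Or.inr ⟨hyz, hay⟩
          rw [ind_of_mem hb, ind_of_mem (show ω ∈ D' ∩ ZW from ⟨hD'ω, hzw⟩)]
        · have hnb : ω ∉ D ∩ Bp := by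
            rintro ⟨-, hb⟩
            rcases (mBp ω).1 hb with hz' | ⟨hyz, -⟩
            · exact hzw ((mZW ω).2 (Or.inl hz'))
            · exact hzw ((mZW ω).2 (Or.inr hyz))
          rw [ind_of_not_mem hnb, ind_of_not_mem (fun h => hzw h.2)]
    · have h1 : ω ∉ D ∩ Bp := fun h => hd h.1
      have h2 : ω ∉ D ∩ Gy ∩ Zv := fun h => hd h.1.1
      have h3 : ω ∉ D' ∩ ZW := fun h => hd ((mD' ω).1 h.1).1
      rw [ind_of_not_mem h1, ind_of_not_mem h2, ind_of_not_mem h3, add_zero]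
  -- indicator functionals: `Ẑ` (reach `z` from `s`, read off `C_s`), `gB` (swallow `y`, read off `C_X`), `Ž` (reach `z` from `{s,y}`)
  set Zh : Set (Sym2 V) → ℝ := fun A => if (z = s ∨ ∃ e ∈ A, z ∈ e) then 1 else 0 with hZh
  set gB : Set (Sym2 V) → ℝ := fun B => if (y ∈ X ∨ ∃ e ∈ B, y ∈ e) then 1 else 0 with hgB
  set Zt : Set (Sym2 V) → ℝ := fun A => if (z ∈ ({s, y} : Set V) ∨ ∃ e ∈ A, z ∈ e) then 1 else 0 with hZt
  have hZh01 : ∀ A, 0 ≤ Zh A := fun A => by rw [hZh]; simp only; split_ifs <;> norm_num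
  have hZt01 : ∀ A, 0 ≤ Zt A := fun A => by rw [hZt]; simp only; split_ifs <;> norm_num
  have hZh_mono : Monotone Zh := by
    intro A A' hAA'
    simp only [hZh]
    by_cases h : z = s ∨ ∃ e ∈ A, z ∈ e
    · have h' : z = s ∨ ∃ e ∈ A', z ∈ e := h.imp id fun ⟨e, he, hze⟩ => ⟨e, hAA' he, hze⟩
      rw [if_pos h, if_pos h']
    · rw [if_neg h]; split_ifs <;> norm_num
  have hZt_mono : Monotone Zt := by
    intro A A' hAA'
    simp only [hZt]
    by_cases h : z ∈ ({s, y} : Set V) ∨ ∃ e ∈ A, z ∈ e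
    · have h' : z ∈ ({s, y} : Set V) ∨ ∃ e ∈ A', z ∈ e := h.imp id fun ⟨e, he, hze⟩ => ⟨e, hAA' he, hze⟩
      rw [if_pos h, if_pos h']
    · rw [if_neg h]; split_ifs <;> norm_num
  have hZind : ∀ ω : BondConfig V, ind Zv ω = Zh (openEdgeCluster ω s) := by
    intro ω
    by_cases h : ω ∈ Zv
    · rw [ind_of_mem h, hZh]; simp only
      rw [if_pos ((reachable_iff_exists_mem_openEdgeCluster ω s z).1 h)]
    · rw [ind_of_not_mem h, hZh]; simp only
      rw [if_neg (fun h' => h ((reachable_iff_exists_mem_openEdgeCluster ω s z).2 h'))]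
  have hGyind : ∀ ω : BondConfig V, ind Gy ω = gB (setCl ω X) := by
    intro ω
    by_cases h : ω ∈ Gy
    · rw [ind_of_mem h, hgB]; simp only
      rw [if_pos ((mem_Gy_iff_setCl X y ω).1 h)]
    · rw [ind_of_not_mem h, hgB]; simp only
      rw [if_neg (fun h' => h ((mem_Gy_iff_setCl X y ω).2 h'))]
  have hZWind : ∀ ω : BondConfig V, ind ZW ω = Zt (setCl ω {s, y}) := by
    intro ω
    have hiff : ω ∈ ZW ↔ (z ∈ ({s, y} : Set V) ∨ ∃ e ∈ setCl ω {s, y}, z ∈ e) := by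
      rw [← setReach_iff ω {s, y} z]; exact Iff.rfl
    by_cases h : ω ∈ ZW
    · rw [ind_of_mem h, hZt]; simp only
      rw [if_pos (hiff.1 h)]
    · rw [ind_of_not_mem h, hZt]; simp only
      rw [if_neg (fun h' => h (hiff.2 h'))]
  -- monotonicity in the fresh configuration
  have mono_cl : ∀ K : Set (Sym2 V), Monotone fun η : Set (Sym2 V) => openEdgeCluster (η \ K) s := fun K η η' h =>
    openEdgeCluster_mono (sdiff_le_sdiff_right h) s
  have mono_setCl : ∀ K : Set (Sym2 V), Monotone fun η : Set (Sym2 V) => setCl (η \ K) ({s, y} : Set V) := fun K η η' h =>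
    setCl_mono (sdiff_le_sdiff_right h) {s, y}
  -- rewrite both integrals as sums and split
  rw [setIntegral_eq_sum_ind, setIntegral_eq_sum_ind]
  simp only [hsplit, mul_add, Finset.sum_add_distrib]
  apply add_le_add
  · ----- piece on `D ∩ G_y`: observer union = `{s ↔ z}` read off the fresh `C_s`
    have eL : ∀ ω, weight wr ω * (F (openEdgeCluster ω s) * ind (D ∩ Gy ∩ Zv) ω) =
        weight wr ω * ((fun A B => F A * Zh A * gB B) (setCl ω {s}) (setCl ω X) * ind D ω) := by
      intro ω; rw [ind_inter, ind_inter, setCl_singleton, hZind ω, hGyind ω]; ring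
    have eR : ∀ ω, weight wr ω * (condS wr {s} X F (⋃ x ∈ X, openEdgeCluster ω x) * ind (D ∩ Gy ∩ Zv) ω) =
        weight wr ω * ((fun A B => condS wr {s} X F B * Zh A * gB B) (setCl ω {s}) (setCl ω X) * ind D ω) := by
      intro ω; rw [ind_inter, ind_inter, setCl_singleton, hZind ω, hGyind ω]
      have : (⋃ x ∈ X, openEdgeCluster ω x) = setCl ω X := rfl
      rw [this]; ring
    rw [Finset.sum_congr rfl fun ω _ => eR ω, Finset.sum_congr rfl fun ω _ => eL ω,
      set_sum_cond_cluster' wr hm {s} X (fun A B => condS wr {s} X F B * Zh A * gB B) (mem_D_iff' s X),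
      set_sum_cond_cluster' wr hm {s} X (fun A B => F A * Zh A * gB B) (mem_D_iff' s X)]
    refine Finset.sum_le_sum fun ω _ => mul_le_mul_of_nonneg_left ?_ (weight_nonneg hw0 hw1 ω)
    refine mul_le_mul_of_nonneg_right ?_ (ind_nonneg _ _)
    -- in the world of `ω`: Harris for `η ↦ F(C_s(η ∖ K))` and `η ↦ Ẑ(C_s(η ∖ K))`
    set K : Set (Sym2 V) := barOf X (setCl ω X) with hK
    have hc : condS wr {s} X F (setCl ω X) = ∑ η, weight wr η * F (openEdgeCluster (η \ K) s) := by
      change ∑ η, weight wr η * F (halfS {s} X (setCl ω X) η) = _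
      refine Finset.sum_congr rfl fun η _ => ?_
      rw [halfS, setCl_singleton]
    have hg0 : 0 ≤ gB (setCl ω X) := by rw [hgB]; simp only; split_ifs <;> norm_num
    have lhs : ∑ η, weight wr η * (fun A B => condS wr {s} X F B * Zh A * gB B) (setCl (η \ K) {s}) (setCl ω X) =
        gB (setCl ω X) * (condS wr {s} X F (setCl ω X) * ∑ η, weight wr η * Zh (openEdgeCluster (η \ K) s)) := by
      rw [Finset.mul_sum, Finset.mul_sum]
      refine Finset.sum_congr rfl fun η _ => ?_
      simp only [setCl_singleton]; ring
    have rhs : ∑ η, weight wr η * (fun A B => F A * Zh A * gB B) (setCl (η \ K) {s}) (setCl ω X) =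
        gB (setCl ω X) * ∑ η, weight wr η * (F (openEdgeCluster (η \ K) s) * Zh (openEdgeCluster (η \ K) s)) := by
      rw [Finset.mul_sum]
      refine Finset.sum_congr rfl fun η _ => ?_
      simp only [setCl_singleton]; ring
    rw [lhs, rhs, hc]
    refine mul_le_mul_of_nonneg_left ?_ hg0
    exact harris_shift w (f := fun η => F (openEdgeCluster (η \ K) s)) (g := fun η => Zh (openEdgeCluster (η \ K) s))
      (fun η η' h => hF (mono_cl K h)) (fun η η' h => hZh_mono (mono_cl K h)) (fun η => hZh01 _)
  · ----- piece on `D ∩ {y ↮ X}`: observer union = `{z ↔ {s,y}}` read off the fresh `C_{s,y}`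
    have hsS : s ∈ ({s, y} : Set V) := mem_insert s {y}
    have hD'2 : ∀ ω, ω ∈ D' ↔ ∀ a ∈ X, ∀ t ∈ ({s, y} : Set V), ¬ (openGraph ω).Reachable a t := fun ω => Iff.rfl
    have eL : ∀ ω, weight wr ω * (F (openEdgeCluster ω s) * ind (D' ∩ ZW) ω) =
        weight wr ω * ((fun B A => F (openEdgeCluster A s) * Zt A) (setCl ω X) (setCl ω {s, y}) * ind D' ω) := by
      intro ω; simp only [ind_inter, hZWind ω, openEdgeCluster_setCl ω {s, y} hsS]; ring
    have eR : ∀ ω, weight wr ω * (condS wr {s} X F (⋃ x ∈ X, openEdgeCluster ω x) * ind (D' ∩ ZW) ω) =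
        weight wr ω * ((fun B A => condS wr {s} X F B * Zt A) (setCl ω X) (setCl ω {s, y}) * ind D' ω) := by
      intro ω; rw [ind_inter, hZWind ω]
      have : (⋃ x ∈ X, openEdgeCluster ω x) = setCl ω X := rfl
      rw [this]; ring
    rw [Finset.sum_congr rfl fun ω _ => eR ω, Finset.sum_congr rfl fun ω _ => eL ω,
      set_sum_cond_cluster wr hm X {s, y} (fun B A => condS wr {s} X F B * Zt A) hD'2,
      set_sum_cond_cluster wr hm X {s, y} (fun B A => F (openEdgeCluster A s) * Zt A) hD'2]
    refine Finset.sum_le_sum fun ω _ => mul_le_mul_of_nonneg_left ?_ (weight_nonneg hw0 hw1 ω)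
    refine mul_le_mul_of_nonneg_right ?_ (ind_nonneg _ _)
    set K : Set (Sym2 V) := barOf X (setCl ω X) with hK
    have hc : condS wr {s} X F (setCl ω X) = ∑ η, weight wr η * F (openEdgeCluster (η \ K) s) := by
      change ∑ η, weight wr η * F (halfS {s} X (setCl ω X) η) = _
      refine Finset.sum_congr rfl fun η _ => ?_
      rw [halfS, setCl_singleton]
    have lhs : ∑ η, weight wr η * (fun B A => condS wr {s} X F B * Zt A) (setCl ω X) (setCl (η \ K) {s, y}) =
        condS wr {s} X F (setCl ω X) * ∑ η, weight wr η * Zt (setCl (η \ K) {s, y}) := by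
      rw [Finset.mul_sum]
      refine Finset.sum_congr rfl fun η _ => ?_
      simp only; ring
    have rhs : ∑ η, weight wr η * (fun B A => F (openEdgeCluster A s) * Zt A) (setCl ω X) (setCl (η \ K) {s, y}) =
        ∑ η, weight wr η * (F (openEdgeCluster (η \ K) s) * Zt (setCl (η \ K) {s, y})) := by
      refine Finset.sum_congr rfl fun η _ => ?_
      simp only [openEdgeCluster_setCl _ {s, y} hsS]
    rw [lhs, rhs, hc]
    exact harris_shift w (f := fun η => F (openEdgeCluster (η \ K) s)) (g := fun η => Zt (setCl (η \ K) {s, y}))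
      (fun η η' h => hF (mono_cl K h)) (fun η η' h => hZt_mono (mono_setCl K h)) (fun η => hZt01 _)

end Consts

end Summit.CriticalPhenomena.PercolationContinuityZ3.Theorems

end
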